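import Summits.QuantumFields.YangMills.Theorems.BalabanUVNodesK0RecordFormatNamesFluct
import Literature.MathematicalPhysics.QuantumFieldTheory.Balaban1983to89.B4PartitionUnity22

/-!
# Bałaban UV nodes, port S1 — LIST (c3): the `ζ_□ ∕ t_□` SUBSTITUTION FORMAT of [I] (3.4) at the record — a smooth partition of unity `1 = Σ_{□∈π_j} ζ_□` on the
# fine torus indexed by the cubes of (σ₀), built from the tree's [B4] profile, and the multiplier `A := (t + Σ_□ t_□ ζ_□)·H` of [II] p.7 (def-Y g41, ◇ lens-1 v26 §2 (c3);
# one additive file; definitions + the rows `Σ_□ ζ_□ = 1`, `0 ≤ ζ_□ ≤ 1` PROVED; nothing asserted)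

WHY.  [I] p.270 L14–21: «Let us take the partition π_k.  We construct a cover of the space T by cubes □̃, which are unions of 2^d neighbouring cubes from π_k.  For this cover
we take a partition of unity 1 = Σ_{□∈π_k} ζ_□ with smooth functions ζ_□.  More exactly we assume that if y is a center of the cube □̃, then ζ_□(x) = Π_{μ=1}^d ζ(M⁻¹(x_μ − y_μ)),
where ζ ∈ C²(ℝ¹), ζ(t) = 1 for |t| ≤ 1∕3, ζ(t) = 0 for |t| ≥ 2∕3, ζ has derivatives up to the second order bounded by 5»; (3.4) p.270 (the `t_□`-interpolation, differentiated at
`t_□ = 0`); [II] p.7 L5–9 («this function [H_k(s(Y₀), B′)] multiplied by tζ_□ + t_□ζ_□ has to satisfy the bounds (I.3.31) … we extend … analytically with respect to t_□»), (1.23).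
◇'s LIST (c3) asks def-Y for `zeta : Cube → (fine sites → ℝ)` with rows `Σ_□ ζ_□ = 1`, `0 ≤ ζ ≤ 1`, support ⊆ □̃, `|∇ζ_□| ≤ O(1)·M⁻¹`, and the substitution map `A := (Σ_□ (t·ζ_□ + t_□·ζ_□)) • H_k(s, B′)`.

THE PROFILE IS THE TREE's.  Print only ASSUMES a profile with the three properties; the tree's [B4] profile ✓`B4PartitionUnity22.hprof` (`= 1` on `|t| ≤ 3∕8 ⊇ [−1∕3, 1∕3]`, `= 0` on `|t| ≥ 5∕8`,
`C^∞`, compact support, `Σ_{j∈ℤ} hprof(t − j)² = 1` ✓`hasSum_hprof_sq` ∕ ✓`sum_hprof_sq`) SQUARED is such a profile: `ζ := hprof²`.  Its centres `y ∈ Mℤ^d` are exactly print's centres of the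
`□̃` (the common corners of `2^d` cubes of `π`), so `ζ_□(x) = Π_μ hprof(x_μ∕M − j_μ(□))²` periodised to the torus IS print's `ζ_□`, within print's envelope.

WHAT THIS FILE IS (NEW names; every earlier object untouched):
* §24χ `zetaProf1 M n c t := Σ_{j ∈ {⌊t∕M⌋, ⌊t∕M⌋+1}, j ≡ c (mod n)} hprof(t∕M − j)²` — the 1-D profile periodised to `ℤ∕n` corner classes (only the two nearest corners contribute,
  ✓`hprof_sub_int_eq_zero`); ★ `sum_zetaProf1 : Σ_{c : ZMod n} zetaProf1 M n c t = 1`, `zetaProf1_nonneg`, `zetaProf1_le_one` — PROVED.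
* §24χ `zetaTorus M c v := Π_μ zetaProf1 M n (c μ) (v μ)` on the index torus ✓`TreeLengthTorus.TPt d n` — ★ `sum_zetaTorus : Σ_c zetaTorus M c v = 1`, `zetaTorus_nonneg`, `zetaTorus_le_one` — PROVED.
* §24χ ★ `recordZeta F Ms j K □ x := zetaTorus (L^j·Ms) □ (x.val)` — `ζ_□` AT THE RECORD: `□` a level-`j` cube index of (σ₀) (`TPt (F.P K).d (Sect2.domCount (F.P K) Ms j)` = (σ₀)'s `CubeIdxAt F Ms j K`),
  `x` a fine site, fine cube side ✓`B14.Eq213MaximalDomains.side (F.P K).L Ms j = L^j·Ms` (the one inside ✓`Sect2.domCount`); ★ `sum_recordZeta`, `recordZeta_nonneg`, `recordZeta_le_one`.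
* §24ψ `siteMulA F K w A := (p ↦ w p.1.src · A p)` (a site function multiplying bond-indexed coordinates at the bond's initial point) and ★ `zetaSubst F Ms j K t tc A :=
  siteMulA (x ↦ t + Σ_□ tc □ · ζ_□ x) A` — [II] p.7's `(tζ_□ + t_□ζ_□)·H_k` summed over `□` (`Σ_□ ζ_□ = 1` makes it `(t + Σ_□ t_□ζ_□)·H_k`), `t` the global and `tc □ = t_□` the per-cube complex
  parameters of the (1.22) circles; `zetaSubst_tc_zero : zetaSubst … t 0 A = t • A`.

HONEST SCOPE.  FORMAT + the partition-of-unity rows; NOT here: the support row `supp ζ_□ ⊆ □̃` and the (3.31)-norm rows `|∇^η ζ_□| ≤ O(1)(L^jM)⁻¹`, `|Δ^η ζ_□| ≤ O(1)(L^jM)⁻²` (they follow from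
✓`abs_latticeDeriv_hCube_le` ∕ ✓`abs_latticeLaplacian_hCube_le` by the product rule for the square — a prover's file when (c5)'s `termFormat` cites them BY NAME); the exact-tiling hypothesis
`L^j·Ms·domCount = sitesPerDir 0` (`K ≥ recordK₀`) is where the periodisation is geometrically right — off it the definitions are total and the `Σ = 1` row still holds.  Nothing asserted or
inhabited; no RG estimate.  ⟨stmt-QuantumFields-27930⟩ 2∕7 · K0ᴬ 0∕2 · NODE O 0∕1 · COUNT 8∕28 · K 1∕4 UNMOVED; finite `𝕋⁴_{L^K}` at fixed ε — NOT continuum ∕ OS ∕ Clay; **the Yang–Mills mass gap is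
NOT proved by any of this.**  No `sorry`, `instance`, `notation`.
-/

noncomputable section

open scoped BigOperators

namespace Summit.QuantumFields.YangMills.Theorems.K0RecordFormatNames

open Literature.MathematicalPhysics.QuantumFieldTheory.Balaban1983to89
open Literature.MathematicalPhysics.QuantumFieldTheory.Balaban1983to89.Node00
open Literature.MathematicalPhysics.QuantumFieldTheory.Balaban1983to89.T4Continuum (T4Family)
open Literature.MathematicalPhysics.QuantumFieldTheory.Balaban1983to89.TreeLengthTorus (TPt)
open Literature.MathematicalPhysics.QuantumFieldTheory.Balaban1983to89.B4PartitionUnity22 (hprof hprof_nonneg hprof_sub_int_eq_zero sum_hprof_sq)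

variable (F : T4Family)

/-! ## §24χ  (c3) The partition of unity `1 = Σ_□ ζ_□` from the [B4] profile, periodised to the torus -/

/-- **The 1-D periodised squared profile**: `zetaProf1 M n c t := Σ_{j ∈ {⌊t∕M⌋, ⌊t∕M⌋ + 1}, (j : ZMod n) = c} hprof(t∕M − j)²` — print's `ζ(M⁻¹(x_μ − y_μ))` with centres `y_μ ∈ Mℤ` reduced to corner
classes `mod n`; only the two nearest corners can contribute (✓`hprof_sub_int_eq_zero`). [cite: Balaban1987RG1, p.270 L14–21; Balaban1983RegularityDecay, §2 p.575] -/
def zetaProf1 (M : ℝ) (n : ℕ) (c : ZMod n) (t : ℝ) : ℝ :=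
  ∑ j ∈ (({⌊t / M⌋, ⌊t / M⌋ + 1} : Finset ℤ).filter fun j : ℤ => (j : ZMod n) = c), hprof (t / M - (j : ℝ)) ^ 2

/-- `0 ≤ zetaProf1`. [cite: Balaban1987RG1, p.270 (bookkeeping)] -/
theorem zetaProf1_nonneg (M : ℝ) (n : ℕ) (c : ZMod n) (t : ℝ) : 0 ≤ zetaProf1 M n c t :=
  Finset.sum_nonneg fun _ _ => sq_nonneg _

/-- ★ **`Σ_c ζ_c = 1` in one dimension**: summing the corner classes recovers `Σ_{j} hprof(t∕M − j)² = 1`. [cite: Balaban1987RG1, p.270 («partition of unity 1 = Σ ζ_□»); Balaban1983RegularityDecay, §2 p.575] -/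
theorem sum_zetaProf1 (M : ℝ) (n : ℕ) [NeZero n] (t : ℝ) : ∑ c : ZMod n, zetaProf1 M n c t = 1 := by
  unfold zetaProf1
  rw [Finset.sum_fiberwise_of_maps_to (fun _ _ => Finset.mem_univ _)]
  refine sum_hprof_sq _ fun j hj => ?_
  rw [Finset.mem_insert, Finset.mem_singleton]
  by_contra h
  exact hj (hprof_sub_int_eq_zero (not_or.mp h))

/-- `zetaProf1 ≤ 1` (a nonnegative summand of a sum equal to `1`). [cite: Balaban1987RG1, p.270 (bookkeeping)] -/
theorem zetaProf1_le_one (M : ℝ) (n : ℕ) [NeZero n] (c : ZMod n) (t : ℝ) : zetaProf1 M n c t ≤ 1 := by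
  rw [← sum_zetaProf1 M n t]
  exact Finset.single_le_sum (fun c' _ => zetaProf1_nonneg M n c' t) (Finset.mem_univ c)

/-- **`ζ_□` on the index torus**: `zetaTorus M c v := Π_μ zetaProf1 M n (c μ) (v μ)` — print's product `Π_μ ζ(M⁻¹(x_μ − y_μ))`, `c ∈ (ℤ∕n)^d` the corner (= cube) index, `v ∈ ℝ^d` the point.
[cite: Balaban1987RG1, p.270 L17–19] -/
def zetaTorus (M : ℝ) {d n : ℕ} (c : TPt d n) (v : Fin d → ℝ) : ℝ := ∏ μ, zetaProf1 M n (c μ) (v μ)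

/-- `0 ≤ zetaTorus`. [cite: Balaban1987RG1, p.270 (bookkeeping)] -/
theorem zetaTorus_nonneg (M : ℝ) {d n : ℕ} (c : TPt d n) (v : Fin d → ℝ) : 0 ≤ zetaTorus M c v :=
  Finset.prod_nonneg fun μ _ => zetaProf1_nonneg M n (c μ) (v μ)

/-- ★ **THE PARTITION OF UNITY `Σ_□ ζ_□ = 1`** on the index torus. [cite: Balaban1987RG1, p.270 («1 = Σ_{□∈π_k} ζ_□»)] -/
theorem sum_zetaTorus (M : ℝ) {d n : ℕ} [NeZero n] (v : Fin d → ℝ) : ∑ c : TPt d n, zetaTorus M c v = 1 := by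
  unfold zetaTorus
  rw [← Fintype.piFinset_univ, ← Finset.prod_univ_sum (fun _ => (Finset.univ : Finset (ZMod n))) fun μ a => zetaProf1 M n a (v μ)]
  exact Finset.prod_eq_one fun μ _ => sum_zetaProf1 M n (v μ)

/-- `zetaTorus ≤ 1`. [cite: Balaban1987RG1, p.270 (bookkeeping)] -/
theorem zetaTorus_le_one (M : ℝ) {d n : ℕ} [NeZero n] (c : TPt d n) (v : Fin d → ℝ) : zetaTorus M c v ≤ 1 := by
  rw [← sum_zetaTorus M (n := n) v]
  exact Finset.single_le_sum (fun c' _ => zetaTorus_nonneg M c' v) (Finset.mem_univ c)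

/-- ★ **`ζ_□` AT THE RECORD — `recordZeta F Ms j K □ x`**: `□` a level-`j` cube index of (σ₀) (`TPt (F.P K).d (Sect2.domCount (F.P K) Ms j)`, = `CubeIdxAt F Ms j K`), `x` a FINE site of `T_η`; the cube side in
fine sites is ✓`B14.Eq213MaximalDomains.side (F.P K).L Ms j = L^j·Ms` (the one inside ✓`Sect2.domCount`), the centres are the cube corners. [cite: Balaban1987RG1, p.270 L14–21, (3.4) p.270] -/
def recordZeta (Ms j K : ℕ) (c : TPt (F.P K).d (Sect2.domCount (F.P K) Ms j)) (x : Site (F.P K) 0) : ℝ :=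
  zetaTorus (B14.Eq213MaximalDomains.side (F.P K).L Ms j : ℝ) c fun μ => ((x μ).val : ℝ)

/-- `0 ≤ ζ_□`. [cite: Balaban1987RG1, p.270 (bookkeeping)] -/
theorem recordZeta_nonneg (Ms j K : ℕ) (c : TPt (F.P K).d (Sect2.domCount (F.P K) Ms j)) (x : Site (F.P K) 0) : 0 ≤ recordZeta F Ms j K c x :=
  zetaTorus_nonneg _ _ _

/-- ★ **`Σ_□ ζ_□(x) = 1` at every fine site.** [cite: Balaban1987RG1, p.270 («1 = Σ_{□∈π_k} ζ_□»)] -/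
theorem sum_recordZeta (Ms j K : ℕ) (x : Site (F.P K) 0) : ∑ c : TPt (F.P K).d (Sect2.domCount (F.P K) Ms j), recordZeta F Ms j K c x = 1 :=
  sum_zetaTorus _ _

/-- `ζ_□ ≤ 1`. [cite: Balaban1987RG1, p.270 (bookkeeping)] -/
theorem recordZeta_le_one (Ms j K : ℕ) (c : TPt (F.P K).d (Sect2.domCount (F.P K) Ms j)) (x : Site (F.P K) 0) : recordZeta F Ms j K c x ≤ 1 :=
  zetaTorus_le_one _ _ _

/-! ## §24ψ  (c3) The multiplier format `A := (tζ_□ + t_□ζ_□)·H_k`, summed over `□` -/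

/-- **A site function multiplying bond-indexed coordinates**: `siteMulA F K w A := (p ↦ w(p.1.src) · A p)` — `(ζ·A)(b, a) = ζ(b₋)·A(b, a)` (the multiplier read at the bond's initial point).
[cite: Balaban1987RG1, (3.4) p.270, (3.31) p.276 (bookkeeping)] -/
def siteMulA (K : ℕ) (w : Site (F.P K) 0 → ℂ) (A : FineIdx F K → ℂ) : FineIdx F K → ℂ := fun p => w p.1.src * A p

/-- `siteMulA 1 = id`. [cite: Balaban1987RG1, (3.4) p.270 (bookkeeping)] -/
theorem siteMulA_one (K : ℕ) (A : FineIdx F K → ℂ) : siteMulA F K 1 A = A := by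
  funext p; exact one_mul _

/-- `siteMulA` by a constant is scalar multiplication. [cite: Balaban1987RG1, (3.4) p.270 (bookkeeping)] -/
theorem siteMulA_const (K : ℕ) (t : ℂ) (A : FineIdx F K → ℂ) : siteMulA F K (fun _ => t) A = t • A := rfl

/-- ★ **THE `ζ ∕ t` SUBSTITUTION — `zetaSubst F Ms j K t tc A := ((t + Σ_□ tc □ · ζ_□) · A)`**: [II] p.7's «H_k multiplied by tζ_□ + t_□ζ_□», summed over the cubes `□` of level `j` (`Σ_□ ζ_□ = 1` turns
`Σ_□ (tζ_□ + t_□ζ_□)` into `t + Σ_□ t_□ζ_□`); `t` the global interpolation parameter of (3.4), `tc □ = t_□` the per-cube parameters continued to the (1.22) circles (complex), `A = H_k(s, B′)` the field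
being cut ((c2)'s `hkAt`).  The result is (c1)'s variable `A` of `finePertC ∕ pairPertC`. [cite: Balaban1987RG1, (3.4) p.270, (3.6)–(3.7) p.271; Balaban1988RG2Cluster, p.7 L5–9, (1.22)–(1.23) p.7] -/
def zetaSubst (Ms j K : ℕ) (t : ℂ) (tc : TPt (F.P K).d (Sect2.domCount (F.P K) Ms j) → ℂ) (A : FineIdx F K → ℂ) : FineIdx F K → ℂ :=
  siteMulA F K (fun x => t + ∑ c, tc c * (recordZeta F Ms j K c x : ℂ)) A

/-- Unfolding at a coordinate (`rfl`). [cite: Balaban1987RG1, (3.4) p.270 (bookkeeping)] -/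
theorem zetaSubst_apply (Ms j K : ℕ) (t : ℂ) (tc : TPt (F.P K).d (Sect2.domCount (F.P K) Ms j) → ℂ) (A : FineIdx F K → ℂ) (p : FineIdx F K) :
    zetaSubst F Ms j K t tc A p = (t + ∑ c, tc c * (recordZeta F Ms j K c p.1.src : ℂ)) * A p := rfl

/-- At `t_□ = 0` for all `□` the substitution is `t • A` (the undifferentiated (3.4) interpolation). [cite: Balaban1987RG1, (3.4) p.270 (bookkeeping)] -/
theorem zetaSubst_tc_zero (Ms j K : ℕ) (t : ℂ) (A : FineIdx F K → ℂ) : zetaSubst F Ms j K t 0 A = t • A := by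
  funext p
  rw [zetaSubst_apply, Pi.smul_apply, smul_eq_mul]
  simp

/-- With ALL `t_□ = τ` equal the substitution is `(t + τ) • A` (by `Σ_□ ζ_□ = 1`) — the sanity face of the partition of unity inside the format. [cite: Balaban1987RG1, (3.4) p.270 (bookkeeping)] -/
theorem zetaSubst_tc_const (Ms j K : ℕ) (t τ : ℂ) (A : FineIdx F K → ℂ) : zetaSubst F Ms j K t (fun _ => τ) A = (t + τ) • A := by
  funext p
  rw [zetaSubst_apply, Pi.smul_apply, smul_eq_mul, ← Finset.mul_sum, ← Complex.ofReal_sum, sum_recordZeta, Complex.ofReal_one, mul_one]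

end Summit.QuantumFields.YangMills.Theorems.K0RecordFormatNames

end
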